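/-
HONEST FRAMING: certified error envelopes and provably optimal rounding/accumulation schemes for
low-precision formats under stated cost models; every table by two implementations; no hardware
or vendor claims.
-/
import Mathlib.Data.Int.Interval
import Mathlib.Data.Finset.Max
import Summits.Ventures.CertifiedArithmetic.LowPrec.OptTreePoly
import Literature.ComputerArithmetic.JeannerodRump2018.Theorem32

/-!
# Tree polynomial law, part 3: the bound of Theorem U is attained (ties-to-even witness)

Cost model CM-T over the full binary format `F(p, emin)` of [JeannerodRump2018] (precision `p`,
gradual underflow, no overflow), `u = 2^-p`, tree polynomial `M_t(u)` (`treeM`, part 1).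

Part 1 (`OptTreePoly`) proved THEOREM U: for nonnegative floats and ANY round-to-nearest `fl`,
every summation tree `t` satisfies `exact t - eval fl t ≤ (1 - 1/M_t(u)) · exact t`.

This file proves that the constant is SHARP under ties-to-even:

* `wit u s t k` relabels the leaves of `t` (same shape, hence the same tree polynomial,
  `treeM_wit`): at every internal node the child with the larger `M` keeps the current scale
  `s·u^k` and the other child is scaled by a further factor `u`.  Then
  `exact (wit u s t k) = s·u^k·M_t(u)` (`exact_wit`), while every addition performed is
  `fl (x + u·x)` with `x = s·u^j` — under the hypothesis that these midpoints round DOWN to `x`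
  the computed value is `s·u^k` (`eval_wit`): relative under-estimation exactly `1 - 1/M_t(u)`
  (`witness_attains`).
* In the format: with `s = 2^e` and `u = 2^-p` the points `x + u·x = 2^e'(1+u)` are the exact
  midpoints of the consecutive floats `2^e'` and `2^e'(1+2u)`; IEEE roundTiesToEven returns `2^e'`
  (even significand `2^(p-1)`).  `TiesEvenAtPow p emin fl` records exactly this property;
  `exists_roundNearest_tiesEven` shows that round-to-nearest maps into `F(p, emin)` with it EXIST
  (so the hypothesis is not vacuous; uses `exists_nearest`, the existence of a nearest float in the
  bounded-exponent model, proved here), and `treePoly_bound_attained` gives, for every tree `t` and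
  every `e ≥ emin + p·height t`, an input of nonnegative floats of the same shape on which
  `exact - computed = (1 - 1/M_t(u)) · exact`.
* `R4_TreePolySharp` (+ `_holds`) is the Statement-style summary; with
  `R4_TreePolyUnderestimation` (part 1): for ties-to-even nearest rounding the worst-case relative
  under-estimation of EVERY summation tree over nonnegative data is EXACTLY `1 - 1/M_t(u)`, and with
  `R4_PairwiseMinimisesTreePolynomial` (part 2) pairwise summation is exactly optimal for every `n`.

Paper proof and certificates (C13: the law `1 - 1/M_t` re-derived by two independent exact
programmes on `p = 2..5`) in the cell's OPTIMA.md §T, Theorem T4.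
-/

namespace Summit.Ventures.CertifiedArithmetic.LowPrec.Opt

open Literature.ComputerArithmetic.JeannerodRump2018
open Literature.ComputerArithmetic.JeannerodRump2018.SumTree

/-! ## Height and the witness relabelling -/

/-- Height of a summation tree (a leaf has height `0`). -/
def height : SumTree → ℕ
  | .leaf _ => 0
  | .node l r => max (height l) (height r) + 1

/-- `height (leaf x) = 0`. -/
@[simp] theorem height_leaf (x : ℚ) : height (.leaf x) = 0 := rfl

/-- `height (node l r) = max + 1`. -/
@[simp] theorem height_node (l r : SumTree) :
    height (.node l r) = max (height l) (height r) + 1 := rfl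

/-- The witness relabelling of `t` at scale `s·u^k`: a leaf becomes `s·u^k`; at a node the child
with the larger tree polynomial keeps the exponent `k`, the other child gets `k + 1`. -/
def wit (u s : ℚ) : SumTree → ℕ → SumTree
  | .leaf _, k => .leaf (s * u ^ k)
  | .node a b, k =>
      if treeM u b ≤ treeM u a then .node (wit u s a k) (wit u s b (k + 1))
      else .node (wit u s a (k + 1)) (wit u s b k)

/-- The witness has the same tree polynomial (it has the same shape). -/
theorem treeM_wit (u s : ℚ) : ∀ (t : SumTree) (k : ℕ), treeM u (wit u s t k) = treeM u t
  | .leaf x, k => by simp [wit]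
  | .node a b, k => by
      by_cases h : treeM u b ≤ treeM u a
      · simp only [wit, if_pos h, treeM_node, treeM_wit u s a, treeM_wit u s b]
      · simp only [wit, if_neg h, treeM_node, treeM_wit u s a, treeM_wit u s b]

/-- The witness has the same height. -/
theorem height_wit (u s : ℚ) : ∀ (t : SumTree) (k : ℕ), height (wit u s t k) = height t
  | .leaf x, k => by simp [wit]
  | .node a b, k => by
      by_cases h : treeM u b ≤ treeM u a
      · simp only [wit, if_pos h, height_node, height_wit u s a, height_wit u s b]
      · simp only [wit, if_neg h, height_node, height_wit u s a, height_wit u s b]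

/-- Exact sum of the witness: `s·u^k·M_t(u)`. -/
theorem exact_wit (u s : ℚ) : ∀ (t : SumTree) (k : ℕ), exact (wit u s t k) = s * u ^ k * treeM u t
  | .leaf x, k => by simp [wit, exact]
  | .node a b, k => by
      by_cases h : treeM u b ≤ treeM u a
      · simp only [wit, if_pos h, exact, exact_wit u s a, exact_wit u s b, treeM_node,
          max_eq_left h, min_eq_right h]
        ring
      · have h' : treeM u a ≤ treeM u b := le_of_lt (not_le.mp h)
        simp only [wit, if_neg h, exact, exact_wit u s a, exact_wit u s b, treeM_node,
          max_eq_right h', min_eq_left h']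
        ring

/-- Every leaf of the witness is `s·u^j` with `k ≤ j ≤ k + height t`. -/
theorem mem_leaves_wit (u s : ℚ) : ∀ (t : SumTree) (k : ℕ), ∀ x ∈ leaves (wit u s t k),
    ∃ j : ℕ, k ≤ j ∧ j ≤ k + height t ∧ x = s * u ^ j
  | .leaf y, k => by
      intro x hx
      simp [wit, leaves] at hx
      exact ⟨k, le_rfl, by simp, hx⟩
  | .node a b, k => by
      intro x hx
      have hma := le_max_left (height a) (height b)
      have hmb := le_max_right (height a) (height b)
      by_cases h : treeM u b ≤ treeM u a
      · simp only [wit, if_pos h, leaves, List.mem_append] at hx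
        rcases hx with hx | hx
        · obtain ⟨j, hj1, hj2, rfl⟩ := mem_leaves_wit u s a k x hx
          exact ⟨j, hj1, by simp only [height_node]; omega, rfl⟩
        · obtain ⟨j, hj1, hj2, rfl⟩ := mem_leaves_wit u s b (k + 1) x hx
          exact ⟨j, by omega, by simp only [height_node]; omega, rfl⟩
      · simp only [wit, if_neg h, leaves, List.mem_append] at hx
        rcases hx with hx | hx
        · obtain ⟨j, hj1, hj2, rfl⟩ := mem_leaves_wit u s a (k + 1) x hx
          exact ⟨j, by omega, by simp only [height_node]; omega, rfl⟩
        · obtain ⟨j, hj1, hj2, rfl⟩ := mem_leaves_wit u s b k x hx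
          exact ⟨j, hj1, by simp only [height_node]; omega, rfl⟩

/-- Evaluation of the witness when the midpoints `x + u·x`, `x = s·u^j` (`j < N`), round down to
`x`: the computed root is `s·u^k` (every addition is such a midpoint). -/
theorem eval_wit (u s : ℚ) {fl : ℚ → ℚ} {N : ℕ}
    (hT : ∀ j : ℕ, j < N → fl (s * u ^ j + s * u ^ (j + 1)) = s * u ^ j) :
    ∀ (t : SumTree) (k : ℕ), k + height t ≤ N → eval fl (wit u s t k) = s * u ^ k
  | .leaf x, k, _ => by simp [wit, eval]
  | .node a b, k, hk => by
      have hma := le_max_left (height a) (height b)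
      have hmb := le_max_right (height a) (height b)
      simp only [height_node] at hk
      have ha : k + 1 + height a ≤ N := by omega
      have hb : k + 1 + height b ≤ N := by omega
      have ha0 : k + height a ≤ N := by omega
      have hb0 : k + height b ≤ N := by omega
      have hkN : k < N := by omega
      by_cases h : treeM u b ≤ treeM u a
      · simp only [wit, if_pos h, eval, eval_wit u s hT a k ha0, eval_wit u s hT b (k + 1) hb]
        exact hT k hkN
      · simp only [wit, if_neg h, eval, eval_wit u s hT a (k + 1) ha, eval_wit u s hT b k hb0]
        rw [add_comm]
        exact hT k hkN

/-- SHARPNESS (abstract form): under the midpoint hypothesis the witness of `t` at scale `s`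
under-estimates by EXACTLY the factor `1 - 1/M_t(u)` of Theorem U. -/
theorem witness_attains (u s : ℚ) (hu : 0 ≤ u) {fl : ℚ → ℚ} {N : ℕ}
    (hT : ∀ j : ℕ, j < N → fl (s * u ^ j + s * u ^ (j + 1)) = s * u ^ j)
    (t : SumTree) (ht : height t ≤ N) :
    exact (wit u s t 0) - eval fl (wit u s t 0)
      = (1 - 1 / treeM u t) * exact (wit u s t 0) := by
  rw [exact_wit u s, eval_wit u s hT t 0 (by simpa using ht)]
  have hM : 1 ≤ treeM u t := one_le_treeM hu t
  have hM0 : treeM u t ≠ 0 := ne_of_gt (lt_of_lt_of_le one_pos hM)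
  field_simp


/-! ## The midpoints in the format: ties-to-even at the binade points -/

/-- TIES-TO-EVEN AT THE BINADE POINTS: for every `e ≥ emin` the point `2^e (1+u)` rounds to
`2^e`.  For `e ≥ emin + p - 1` this is the exact midpoint of the consecutive floats `2^e` and
`2^e (1+2u)` and `2^e` is the candidate with the even significand `2^(p-1)` (IEEE 754
roundTiesToEven); for `emin ≤ e < emin + p - 1` the float `2^e` is the unique nearest one.  Every
round-to-nearest map agreeing with roundTiesToEven has this property. -/
def TiesEvenAtPow (p : ℕ) (emin : ℤ) (fl : ℚ → ℚ) : Prop :=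
  ∀ e : ℤ, emin ≤ e → fl ((2 : ℚ) ^ e + (2 : ℚ) ^ e * unitRoundoff p) = (2 : ℚ) ^ e

/-- A float of the bounded model is a float of the unbounded one. -/
theorem isFloatU_of_isFloat {p : ℕ} {emin : ℤ} {x : ℚ} (h : IsFloat p emin x) : IsFloatU p x := by
  obtain ⟨M, e, hM, -, rfl⟩ := h
  exact ⟨M, e, hM, rfl⟩

/-- `2^e · u^j = 2^(e - p·j)` for `u = 2^-p`. -/
theorem two_zpow_mul_u_pow (p : ℕ) (e : ℤ) (j : ℕ) :
    (2 : ℚ) ^ e * unitRoundoff p ^ j = (2 : ℚ) ^ (e - ((p * j : ℕ) : ℤ)) := by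
  unfold unitRoundoff
  rw [zpow_sub₀ (by norm_num : (2 : ℚ) ≠ 0), zpow_natCast, one_div_pow, pow_mul]
  ring

/-- No float lies strictly between `2^e` and `2^e + 2^(e+1-p)` (unbounded exponents suffice).
[grid structure, cf. JeannerodRump2018 §2] -/
theorem float_le_or_succ_le {p : ℕ} (hp : 1 ≤ p) {g : ℚ} (hg : IsFloatU p g) (e : ℤ) :
    g ≤ (2 : ℚ) ^ e ∨ (2 : ℚ) ^ e + (2 : ℚ) ^ (e + 1 - p) ≤ g := by
  by_cases hle : g ≤ (2 : ℚ) ^ e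
  · exact Or.inl hle
  · right
    obtain ⟨n, hn⟩ := exists_int_mul_of_lt (p := p) hg (not_le.mp hle)
    have hc : (0 : ℚ) < (2 : ℚ) ^ (e + 1 - p) := zpow_pos (by norm_num) _
    have hpe : (((p - 1 : ℕ) : ℤ) + (e + 1 - p)) = e := by omega
    have h2e : (2 : ℚ) ^ e = (2 : ℚ) ^ (p - 1) * (2 : ℚ) ^ (e + 1 - p) := by
      rw [← zpow_natCast, ← zpow_add₀ (by norm_num : (2 : ℚ) ≠ 0), hpe]
    have hlt : (2 : ℚ) ^ (p - 1) * (2 : ℚ) ^ (e + 1 - p) < (n : ℚ) * (2 : ℚ) ^ (e + 1 - p) := by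
      rw [← h2e, ← hn]; exact not_le.mp hle
    have hn1 : ((2 ^ (p - 1) : ℤ) : ℚ) < (n : ℚ) := by
      push_cast; exact lt_of_mul_lt_mul_right hlt hc.le
    have hn2 : (2 ^ (p - 1) : ℤ) + 1 ≤ n := by
      have : (2 ^ (p - 1) : ℤ) < n := by exact_mod_cast hn1
      omega
    have hn3 : (2 : ℚ) ^ (p - 1) + 1 ≤ (n : ℚ) := by exact_mod_cast hn2
    have := mul_le_mul_of_nonneg_right hn3 hc.le
    rw [hn]; linarith [h2e]

/-- `2^e` is a nearest float to the midpoint `2^e (1+u) = 2^e + 2^(e-p)`: every float `f` is at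
least as far. -/
theorem abs_midpoint_sub_two_zpow_le {p : ℕ} (hp : 1 ≤ p) {emin : ℤ} (e : ℤ) {f : ℚ}
    (hf : IsFloat p emin f) :
    |((2 : ℚ) ^ e + (2 : ℚ) ^ e * unitRoundoff p) - (2 : ℚ) ^ e|
      ≤ |((2 : ℚ) ^ e + (2 : ℚ) ^ e * unitRoundoff p) - f| := by
  have hu : (2 : ℚ) ^ e * unitRoundoff p = (2 : ℚ) ^ (e - p) := by
    unfold unitRoundoff
    rw [zpow_sub₀ (by norm_num : (2 : ℚ) ≠ 0), zpow_natCast]; ring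
  have hc : (2 : ℚ) ^ (e + 1 - p) = 2 * (2 : ℚ) ^ (e - p) := by
    rw [show e + 1 - (p : ℤ) = (e - p) + 1 by ring, zpow_add_one₀ (by norm_num : (2 : ℚ) ≠ 0)]
    ring
  have hpos : (0 : ℚ) < (2 : ℚ) ^ (e - p) := zpow_pos (by norm_num) _
  rw [hu, show (2 : ℚ) ^ e + (2 : ℚ) ^ (e - p) - (2 : ℚ) ^ e = (2 : ℚ) ^ (e - p) by ring,
    abs_of_pos hpos]
  rcases float_le_or_succ_le hp (isFloatU_of_isFloat hf) e with h | h
  · rw [abs_of_nonneg (by linarith)]; linarith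
  · rw [hc] at h
    rw [abs_of_nonpos (by linarith)]; linarith

/-- A NEAREST FLOAT EXISTS in the bounded-exponent model `F(p, emin)` (floats are the integer
multiples `N·2^emin` with `|N| < 2^p·2^(e-emin)`; minimise over the finitely many `N` with
`|N·2^emin| ≤ 2|t|`, `0` being a candidate). -/
theorem exists_nearest (p : ℕ) (emin : ℤ) (t : ℚ) :
    ∃ f : ℚ, IsFloat p emin f ∧ ∀ g : ℚ, IsFloat p emin g → |t - f| ≤ |t - g| := by
  classical
  set c : ℚ := (2 : ℚ) ^ emin with hc_def
  have hc : 0 < c := zpow_pos (by norm_num) _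
  set B : ℤ := ⌈2 * |t| / c⌉ with hB_def
  have hB0 : 0 ≤ B := Int.ceil_nonneg (by positivity)
  set S : Finset ℤ := (Finset.Icc (-B) B).filter (fun N : ℤ => IsFloat p emin ((N : ℚ) * c))
    with hS_def
  have h0S : (0 : ℤ) ∈ S := by
    rw [hS_def, Finset.mem_filter, Finset.mem_Icc]
    refine ⟨⟨by omega, hB0⟩, ?_⟩
    simpa using isFloat_zero p emin
  obtain ⟨N₀, hN₀, hmin⟩ :=
    Finset.exists_min_image S (fun N : ℤ => |t - (N : ℚ) * c|) ⟨0, h0S⟩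
  refine ⟨(N₀ : ℚ) * c, (Finset.mem_filter.mp hN₀).2, fun g hg => ?_⟩
  obtain ⟨N, hN⟩ := hg.exists_int_mul_zpow_emin
  rw [← hc_def] at hN
  by_cases hNB : -B ≤ N ∧ N ≤ B
  · have hNS : N ∈ S := by
      rw [hS_def, Finset.mem_filter, Finset.mem_Icc]
      exact ⟨hNB, hN ▸ hg⟩
    rw [hN]; exact hmin N hNS
  · have h0 : |t - (N₀ : ℚ) * c| ≤ |t| := by simpa using hmin 0 h0S
    have hNabs : B < |N| := by
      have h1 := le_abs_self N
      have h2 := neg_le_abs N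
      omega
    have hNabsQ : (B : ℚ) < |(N : ℚ)| := by
      have : ((B : ℤ) : ℚ) < ((|N| : ℤ) : ℚ) := by exact_mod_cast hNabs
      simpa [Int.cast_abs] using this
    have hle : 2 * |t| / c ≤ B := Int.le_ceil _
    rw [div_le_iff₀ hc] at hle
    have h1 : (B : ℚ) * c < |(N : ℚ)| * c := mul_lt_mul_of_pos_right hNabsQ hc
    have h2 : |(N : ℚ) * c| = |(N : ℚ)| * c := by rw [abs_mul, abs_of_pos hc]
    have h3 := abs_sub_abs_le_abs_sub ((N : ℚ) * c) t
    rw [abs_sub_comm ((N : ℚ) * c) t] at h3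
    rw [hN]; linarith

/-- A round-to-nearest map into `F(p, emin)` exists (any `p`, `emin`). -/
theorem exists_roundNearest (p : ℕ) (emin : ℤ) : ∃ fl : ℚ → ℚ, IsRoundNearest p emin fl := by
  choose fl hF hmin using exists_nearest p emin
  exact ⟨fl, fun t => ⟨hF t, hmin t⟩⟩

/-- ROUND-TO-NEAREST MAPS WITH TIES-TO-EVEN AT THE BINADE POINTS EXIST (`p ≥ 1`): take any
nearest map and send each midpoint `2^e (1+u)`, `e ≥ emin`, to `2^e` (a nearest float by
`abs_midpoint_sub_two_zpow_le`).  So `TiesEvenAtPow` is a non-vacuous hypothesis on nearest maps. -/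
theorem exists_roundNearest_tiesEven {p : ℕ} (hp : 1 ≤ p) (emin : ℤ) :
    ∃ fl : ℚ → ℚ, IsRoundNearest p emin fl ∧ TiesEvenAtPow p emin fl := by
  classical
  obtain ⟨fl₀, hfl₀⟩ := exists_roundNearest p emin
  let P : ℚ → Prop := fun t => ∃ e : ℤ, emin ≤ e ∧ t = (2 : ℚ) ^ e + (2 : ℚ) ^ e * unitRoundoff p
  refine ⟨fun t => if h : P t then (2 : ℚ) ^ (Classical.choose h) else fl₀ t, ?_, ?_⟩
  · intro t
    by_cases h : P t
    · simp only [dif_pos h]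
      obtain ⟨he, ht⟩ := Classical.choose_spec h
      refine ⟨⟨1, Classical.choose h, ?_, he, by simp⟩, fun f hf => ?_⟩
      · have h2 : (2 : ℤ) ^ 1 ≤ 2 ^ p := pow_le_pow_right₀ (by norm_num) hp
        rw [abs_one]; linarith
      · have key := abs_midpoint_sub_two_zpow_le hp (Classical.choose h) hf
        rw [← ht] at key
        exact key
    · simp only [dif_neg h]; exact hfl₀ t
  · intro e he
    have h : P ((2 : ℚ) ^ e + (2 : ℚ) ^ e * unitRoundoff p) := ⟨e, he, rfl⟩
    simp only [dif_pos h]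
    obtain ⟨-, ht⟩ := Classical.choose_spec h
    have h1u : (0 : ℚ) < 1 + unitRoundoff p := by unfold unitRoundoff; positivity
    have hmul : (2 : ℚ) ^ (Classical.choose h) * (1 + unitRoundoff p)
        = (2 : ℚ) ^ e * (1 + unitRoundoff p) := by
      calc (2 : ℚ) ^ (Classical.choose h) * (1 + unitRoundoff p)
          = (2 : ℚ) ^ (Classical.choose h) + (2 : ℚ) ^ (Classical.choose h) * unitRoundoff p := by
            ring
        _ = (2 : ℚ) ^ e + (2 : ℚ) ^ e * unitRoundoff p := ht.symm
        _ = (2 : ℚ) ^ e * (1 + unitRoundoff p) := by ring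
    exact mul_right_cancel₀ h1u.ne' hmul

/-! ## Sharpness in the format -/

/-- THE BOUND OF THEOREM U IS ATTAINED (ties-to-even): for every tree `t` and every `e` with
`emin + p·height t ≤ e`, the witness of `t` at scale `2^e` consists of nonnegative floats of
`F(p, emin)`, has the tree polynomial of `t`, evaluates to `2^e` under any `fl` with
`TiesEvenAtPow`, sums exactly to `2^e·M_t(u)`, and so under-estimates by exactly
`(1 - 1/M_t(u)) · exact`. -/
theorem treePoly_bound_attained {p : ℕ} (hp : 1 ≤ p) {emin : ℤ} {fl : ℚ → ℚ}
    (hT : TiesEvenAtPow p emin fl) (t : SumTree) {e : ℤ}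
    (he : emin + ((p * height t : ℕ) : ℤ) ≤ e) :
    (∀ x ∈ leaves (wit (unitRoundoff p) ((2 : ℚ) ^ e) t 0), IsFloat p emin x ∧ 0 ≤ x) ∧
    treeM (unitRoundoff p) (wit (unitRoundoff p) ((2 : ℚ) ^ e) t 0) = treeM (unitRoundoff p) t ∧
    eval fl (wit (unitRoundoff p) ((2 : ℚ) ^ e) t 0) = (2 : ℚ) ^ e ∧
    exact (wit (unitRoundoff p) ((2 : ℚ) ^ e) t 0) = (2 : ℚ) ^ e * treeM (unitRoundoff p) t ∧
    exact (wit (unitRoundoff p) ((2 : ℚ) ^ e) t 0) - eval fl (wit (unitRoundoff p) ((2 : ℚ) ^ e) t 0)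
      = (1 - 1 / treeM (unitRoundoff p) t) * exact (wit (unitRoundoff p) ((2 : ℚ) ^ e) t 0) := by
  set u := unitRoundoff p with hu_def
  set s : ℚ := (2 : ℚ) ^ e with hs_def
  have hu0 : 0 ≤ u := unitRoundoff_nonneg p
  -- the midpoint hypothesis at the scales s·u^j, j < height t
  have hTj : ∀ j : ℕ, j < height t → fl (s * u ^ j + s * u ^ (j + 1)) = s * u ^ j := by
    intro j hj
    have hpj : p * j ≤ p * height t := Nat.mul_le_mul_left _ hj.le
    have hpj' : ((p * j : ℕ) : ℤ) ≤ ((p * height t : ℕ) : ℤ) := by exact_mod_cast hpj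
    have he' : emin ≤ e - ((p * j : ℕ) : ℤ) := by omega
    have hx : s * u ^ j = (2 : ℚ) ^ (e - ((p * j : ℕ) : ℤ)) := two_zpow_mul_u_pow p e j
    rw [show s * u ^ (j + 1) = s * u ^ j * u by ring, hx]
    exact hT _ he'
  refine ⟨?_, treeM_wit u s t 0, by rw [eval_wit u s hTj t 0 (by simp), pow_zero, mul_one],
    by rw [exact_wit u s]; ring, witness_attains u s hu0 hTj t le_rfl⟩
  intro x hx
  obtain ⟨j, -, hj, rfl⟩ := mem_leaves_wit u s t 0 x hx
  have hpj : p * j ≤ p * height t := Nat.mul_le_mul_left _ (by simpa using hj)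
  have hpj' : ((p * j : ℕ) : ℤ) ≤ ((p * height t : ℕ) : ℤ) := by exact_mod_cast hpj
  have he' : emin ≤ e - ((p * j : ℕ) : ℤ) := by omega
  rw [two_zpow_mul_u_pow p e j]
  refine ⟨⟨1, e - ((p * j : ℕ) : ℤ), ?_, he', by simp⟩, le_of_lt (zpow_pos (by norm_num) _)⟩
  have h2 : (2 : ℤ) ^ 1 ≤ 2 ^ p := pow_le_pow_right₀ (by norm_num) hp
  rw [abs_one]; linarith

/-! ## Statement-level summary -/

/-- RUNG (CM-T over a full binary format; OPTIMA.md Theorem T4(b)): SHARPNESS OF THE TREE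
POLYNOMIAL LAW.  For every precision `p ≥ 1` and every `emin`: (i) round-to-nearest maps into
`F(p, emin)` that round the binade midpoints `2^e(1+u)` to even exist; (ii) for every such map
(in particular IEEE roundTiesToEven) and every summation tree `t` there is an input of nonnegative
floats of the same shape — hence the same tree polynomial — with positive exact sum on which the
computed sum under-estimates by EXACTLY `(1 - 1/M_t(u)) · exact`.  With
`R4_TreePolyUnderestimation` the worst case of every tree is therefore exactly `1 - 1/M_t(u)`. -/
def R4_TreePolySharp : Prop :=
  ∀ (p : ℕ) (emin : ℤ), 1 ≤ p →
    (∃ fl : ℚ → ℚ, IsRoundNearest p emin fl ∧ TiesEvenAtPow p emin fl) ∧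
    ∀ fl : ℚ → ℚ, TiesEvenAtPow p emin fl → ∀ t : SumTree,
      ∃ w : SumTree, treeM (unitRoundoff p) w = treeM (unitRoundoff p) t ∧
        (∀ x ∈ leaves w, IsFloat p emin x ∧ 0 ≤ x) ∧ 0 < exact w ∧
        exact w - eval fl w = (1 - 1 / treeM (unitRoundoff p) t) * exact w

/-- `R4_TreePolySharp` holds. -/
theorem R4_TreePolySharp_holds : R4_TreePolySharp := by
  intro p emin hp
  refine ⟨exists_roundNearest_tiesEven hp emin, fun fl hT t => ?_⟩
  obtain ⟨hleaves, hM, -, hexact, hatt⟩ :=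
    treePoly_bound_attained hp hT t (e := emin + ((p * height t : ℕ) : ℤ)) le_rfl
  refine ⟨_, hM, hleaves, ?_, hatt⟩
  rw [hexact]
  have h1 : 1 ≤ treeM (unitRoundoff p) t := one_le_treeM (unitRoundoff_nonneg p) t
  have h2 : (0 : ℚ) < (2 : ℚ) ^ (emin + ((p * height t : ℕ) : ℤ)) := zpow_pos (by norm_num) _
  exact mul_pos h2 (lt_of_lt_of_le one_pos h1)

end Summit.Ventures.CertifiedArithmetic.LowPrec.Opt
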